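import Literature.Probability.RandomPlanarGeometry.SLERestrictionHitPath
import Literature.Probability.RandomPlanarGeometry.LoewnerBoundaryExtension
import Literature.Probability.RandomPlanarGeometry.LoewnerHullHitting
import HarnessLib

/-!
# Discharge of `IsSmoothHull.hitPath_tendsto`: `g_T(β(x)) - W_T → 0` along a hit path

The named fact `IsSmoothHull.hitPath_tendsto` (`SLERestrictionHitPath`; [LSW] proof of
Lemma 6.3: "`β̂(x) = g_T(β(x)) - W_T … → 0` as `x → 1`") is PROVED here
(`IsSmoothHull.hitPath_tendsto_holds`), for every continuous driving function:

1. the hit point `z₀ = β(1) = γ(s₀)` has swallowing time exactly `T`, so its trajectory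
   approaches the driving function, `g_s(z₀) - W_s → 0` as `s ↗ T`
   (`tendsto_map_sub_driving_of_swallowingTime_eq`, `LoewnerHullHitting`): pick `s < T` close to
   `T` with `|g_s(z₀) - W_s|` small and `W` almost constant on `[s, T]`;
2. `g_s` is continuous at `z₀` (`T_{z₀} = T > s`), so `w = g_s(β x)` is close to `W_s` for `x`
   close to `1`;
3. from time `s` to `T` the flow is the Loewner flow of the shifted driving function
   (`map_add`), which displaces every point of its domain by at most `2M + 13√(T - s)`
   (`norm_map_sub_self_le_of_mem_domain`, `LoewnerBoundaryExtension`), `M` the oscillation of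
   `W` on `[s, T]`;
hence `|g_T(β x) - W_T| ≤ |g_T(β x) - w| + |w - W_s| + |W_s - W_T|` is small.
-/

noncomputable section

open Set Filter Metric Complex
open _root_.Topology
open UpperHalfPlane (upperHalfPlaneSet isOpen_upperHalfPlaneSet)
open scoped NNReal

namespace Literature.Probability.RandomPlanarGeometry

namespace Loewner

variable {W : ℝ≥0 → ℝ}

/-- **Near the end of a swallowed point's life, the time-`T` map is close to `W_T` near that
point.** If `z₀ ∈ ℍ` has `T_{z₀} = T`, then for every `ε > 0` there is `ρ > 0` such that every
`z` with `‖z - z₀‖ < ρ` and `T < T_z` has `‖g_T(z) - W_T‖ < ε`. [cite: LawlerSchrammWerner2003Restriction, proof of Lemma 6.3 (β̂(x) → 0)] -/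
theorem exists_forall_norm_map_sub_driving_lt (hW : Continuous W) {z₀ : ℂ} (hz₀ : z₀ ∈ upperHalfPlaneSet)
    {τ : ℝ≥0} (hT : swallowingTime W z₀ = τ) {ε : ℝ} (hε : 0 < ε) :
    ∃ ρ > 0, ∀ z : ℂ, ‖z - z₀‖ < ρ → (τ : WithTop ℝ≥0) < swallowingTime W z →
      ‖map W τ z - W τ‖ < ε := by
  have hη : 0 < ε / 8 := by positivity
  -- `τ > 0`
  have hτpos : 0 < τ := by
    have h0 : z₀ ≠ W 0 := fun h ↦ by
      have : (0 : ℝ) < z₀.im := hz₀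
      rw [h, Complex.ofReal_im] at this
      exact lt_irrefl _ this
    have := swallowingTime_pos_holds hW h0
    rw [hT] at this
    exact_mod_cast this
  -- uniform continuity of `W` on `[0, τ]`
  obtain ⟨Δ₀, hΔ₀, hmod⟩ : ∃ Δ₀ > 0, ∀ u v : ℝ≥0, u ≤ τ → v ≤ τ → dist u v < Δ₀ → dist (W u) (W v) < ε / 8 := by
    have huc : UniformContinuousOn W (Icc 0 τ) := isCompact_Icc.uniformContinuousOn_of_continuous hW.continuousOn
    rw [Metric.uniformContinuousOn_iff] at huc
    obtain ⟨Δ₀, hΔ₀, h⟩ := huc (ε / 8) hη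
    exact ⟨Δ₀, hΔ₀, fun u v hu hv huv ↦ h u ⟨bot_le, hu⟩ v ⟨bot_le, hv⟩ huv⟩
  -- a time step `Δ` with `13 √Δ ≤ ε/8`, `Δ < Δ₀`, `Δ < τ`
  obtain ⟨Δ, hΔpos, hΔ₀', hΔτ, hΔsqrt⟩ : ∃ Δ : ℝ, 0 < Δ ∧ Δ < Δ₀ ∧ Δ < τ ∧ 13 * Real.sqrt Δ ≤ ε / 8 := by
    refine ⟨min (min (Δ₀ / 2) (τ / 2)) ((ε / 104) ^ 2), ?_, ?_, ?_, ?_⟩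
    · have : (0 : ℝ) < τ := hτpos
      positivity
    · have : min (min (Δ₀ / 2) ((τ : ℝ) / 2)) ((ε / 104) ^ 2) ≤ Δ₀ / 2 := (min_le_left _ _).trans (min_le_left _ _)
      linarith
    · have h1 : min (min (Δ₀ / 2) ((τ : ℝ) / 2)) ((ε / 104) ^ 2) ≤ τ / 2 := (min_le_left _ _).trans (min_le_right _ _)
      have : (0 : ℝ) < τ := hτpos
      linarith
    · have h1 : min (min (Δ₀ / 2) ((τ : ℝ) / 2)) ((ε / 104) ^ 2) ≤ (ε / 104) ^ 2 := min_le_right _ _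
      have h2 : Real.sqrt (min (min (Δ₀ / 2) ((τ : ℝ) / 2)) ((ε / 104) ^ 2)) ≤ ε / 104 := by
        rw [Real.sqrt_le_left (by positivity)]; exact h1
      linarith
  -- a time `s ∈ (τ - Δ, τ)` with `‖g_s(z₀) - W_s‖ < ε/8`
  have hlim := tendsto_map_sub_driving_of_swallowingTime_eq hW hz₀ hT
  rw [Metric.tendsto_nhds] at hlim
  haveI : (𝓝[<] τ).NeBot := nhdsLT_neBot_of_exists_lt ⟨0, hτpos⟩
  obtain ⟨s, hs1, hs2⟩ : ∃ s : ℝ≥0, ‖map W s z₀ - W s‖ < ε / 8 ∧ s ∈ Ioo (τ - Δ.toNNReal) τ := by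
    have h1 : ∀ᶠ s : ℝ≥0 in 𝓝[<] τ, s ∈ Ioo (τ - Δ.toNNReal) τ := by
      refine Ioo_mem_nhdsLT ?_
      exact tsub_lt_self hτpos (Real.toNNReal_pos.2 hΔpos)
    obtain ⟨s, hs⟩ := ((hlim (ε / 8) hη).and h1).exists
    rw [dist_zero_right] at hs
    exact ⟨s, hs.1, hs.2⟩
  have hsτ : s < τ := hs2.2
  have hsT : (s : WithTop ℝ≥0) < swallowingTime W z₀ := by rw [hT]; exact WithTop.coe_lt_coe.2 hsτ
  -- the step `Δ' = τ - s ≤ Δ`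
  set Δ' : ℝ≥0 := τ - s with hΔ'
  have hsΔ' : s + Δ' = τ := by rw [hΔ']; exact add_tsub_cancel_of_le hsτ.le
  have hΔ'le : (Δ' : ℝ) ≤ Δ := by
    have h1 : τ - Δ.toNNReal < s := hs2.1
    have h2 : (Δ' : ℝ) = τ - s := by rw [hΔ', NNReal.coe_sub hsτ.le]
    rw [h2]
    have h3 : ((τ - Δ.toNNReal : ℝ≥0) : ℝ) = τ - Δ := by
      rw [NNReal.coe_sub (by
        rw [← NNReal.coe_le_coe, Real.coe_toNNReal _ hΔpos.le]; exact hΔτ.le), Real.coe_toNNReal _ hΔpos.le]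
    have h4 : (τ : ℝ) - Δ < s := by rw [← h3]; exact_mod_cast h1
    linarith
  -- continuity of `g_s` at `z₀`
  have hcont := continuousAt_map hW hsT
  rw [Metric.continuousAt_iff] at hcont
  obtain ⟨ρ, hρ, hρcont⟩ := hcont (ε / 8) hη
  have hz₀im : 0 < z₀.im := hz₀
  refine ⟨min ρ z₀.im, lt_min hρ hz₀im, fun z hz hzT ↦ ?_⟩
  have hzρ : ‖z - z₀‖ < ρ := lt_of_lt_of_le hz (min_le_left _ _)
  have hzH : z ∈ upperHalfPlaneSet := by
    show 0 < z.im
    have h1 : |(z - z₀).im| ≤ ‖z - z₀‖ := Complex.abs_im_le_norm _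
    rw [Complex.sub_im] at h1
    have h2 := lt_of_lt_of_le hz (min_le_right _ _)
    linarith [(abs_le.1 (h1.trans h2.le)).1, (abs_lt.1 (lt_of_le_of_lt h1 h2)).1]
  have hzs : (s : WithTop ℝ≥0) < swallowingTime W z := lt_trans (WithTop.coe_lt_coe.2 hsτ) hzT
  -- `w = g_s z` is close to `W_s`
  set w : ℂ := map W s z with hw
  have hw1 : ‖w - map W s z₀‖ < ε / 8 := by rw [← dist_eq_norm]; exact hρcont (by rwa [dist_eq_norm])
  have hwH : w ∈ upperHalfPlaneSet := mapsTo_map hW s ((mem_domain_iff W s z).2 ⟨hzH, hzs⟩)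
  -- the shifted flow from time `s` to `τ`
  set W' : ℝ≥0 → ℝ := fun u ↦ W (s + u) with hW'
  have hW'c : Continuous W' := continuous_shift W hW s
  have hzT' : ((s + Δ' : ℝ≥0) : WithTop ℝ≥0) < swallowingTime W z := by rw [hsΔ']; exact hzT
  obtain ⟨hwT', hmap⟩ := map_add hW hzT'
  rw [hsΔ'] at hmap
  have hwdom : w ∈ domain W' Δ' := (mem_domain_iff W' Δ' w).2 ⟨hwH, hwT'⟩
  have hM : ∀ u ∈ Icc (0 : ℝ) Δ', ‖(W' u.toNNReal : ℂ) - (W s : ℝ)‖ ≤ ε / 8 := by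
    intro u hu
    rw [← Complex.ofReal_sub, Complex.norm_real, Real.norm_eq_abs, ← Real.dist_eq]
    have hule : u.toNNReal ≤ Δ' := Real.toNNReal_le_iff_le_coe.2 hu.2
    refine le_of_lt (hmod (s + u.toNNReal) s ?_ hsτ.le ?_)
    · rw [← hsΔ']; exact add_le_add le_rfl hule
    · rw [NNReal.dist_eq, NNReal.coe_add, Real.coe_toNNReal _ hu.1, add_sub_cancel_left, abs_of_nonneg hu.1]
      exact lt_of_le_of_lt hu.2 (hΔ'le.trans_lt hΔ₀')
  have hdisp := norm_map_sub_self_le_of_mem_domain hW'c hM hwdom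
  have hsqrt : Real.sqrt Δ' ≤ Real.sqrt Δ := Real.sqrt_le_sqrt hΔ'le
  -- `|W_s - W_τ| < ε/8`
  have hWs : ‖((W s : ℝ) : ℂ) - (W τ : ℝ)‖ < ε / 8 := by
    rw [← Complex.ofReal_sub, Complex.norm_real, Real.norm_eq_abs, ← Real.dist_eq]
    refine hmod s τ hsτ.le le_rfl ?_
    rw [NNReal.dist_eq, abs_sub_comm, abs_of_nonneg (by
      have : (s : ℝ) ≤ τ := NNReal.coe_le_coe.2 hsτ.le
      linarith)]
    have : (τ : ℝ) - s = Δ' := by rw [hΔ', NNReal.coe_sub hsτ.le]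
    rw [this]; linarith
  -- conclusion
  rw [hmap]
  calc ‖map W' Δ' w - W τ‖
      = ‖(map W' Δ' w - w) + (w - map W s z₀) + (map W s z₀ - W s) + ((W s : ℂ) - W τ)‖ := by ring_nf
    _ ≤ ‖map W' Δ' w - w‖ + ‖w - map W s z₀‖ + ‖map W s z₀ - W s‖ + ‖(W s : ℂ) - W τ‖ := by
        refine (norm_add_le _ _).trans (add_le_add ((norm_add_le _ _).trans (add_le_add (norm_add_le _ _) le_rfl)) le_rfl)
    _ ≤ (2 * (ε / 8) + 13 * Real.sqrt Δ') + ε / 8 + ε / 8 + ε / 8 := by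
        gcongr
    _ < ε := by nlinarith [hsqrt, hΔsqrt, Real.sqrt_nonneg Δ']

end Loewner

/-- **Discharge of the named fact `IsSmoothHull.hitPath_tendsto`** ([LSW] proof of Lemma 6.3,
"`β̂(x) → 0` as `x → 1`"): along a smooth hit path, `g_T(β(x)) - W_T → 0` as `x → 1⁻`.
[cite: LawlerSchrammWerner2003Restriction, proof of Lemma 6.3] -/
theorem IsSmoothHull.hitPath_tendsto_holds : IsSmoothHull.hitPath_tendsto := by
  intro W hW A γ γ' hAw hA τ hτ hreal s₀ hs₀ hK β β' hβ
  rw [Metric.tendsto_nhds]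
  intro ε hε
  have hz₀ := hAw.apply_mem_frontier hs₀
  have hz₀H : γ s₀ ∈ upperHalfPlaneSet := hz₀.1
  have hz₀A : γ s₀ ∈ A := hA.isBoundedHull.isClosed.frontier_subset hz₀.2
  have hT : Loewner.swallowingTime W (γ s₀) = τ :=
    le_antisymm hK.2 (hτ.le_swallowingTime hA.isBoundedHull.subset_closure hz₀A)
  obtain ⟨ρ, hρ, hgood⟩ := Loewner.exists_forall_norm_map_sub_driving_lt hW hz₀H hT hε
  have hAarc : IsArcHull A := hAw.isSmoothHull.isArcHull
  have h1 : ∀ᶠ x in 𝓝[<] (1 : ℝ), x ∈ Ico (0 : ℝ) 1 :=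
    mem_of_superset (Ioo_mem_nhdsLT zero_lt_one) fun x hx ↦ ⟨hx.1.le, hx.2⟩
  have hle : 𝓝[<] (1 : ℝ) ≤ 𝓝[Icc (0 : ℝ) 1] 1 :=
    nhdsWithin_le_iff.2 (mem_of_superset (Ioo_mem_nhdsLT zero_lt_one) fun x hx ↦ ⟨hx.1.le, hx.2.le⟩)
  have h2 : ∀ᶠ x in 𝓝[<] (1 : ℝ), dist (β x) (β 1) < ρ := by
    have hc := hβ.continuousOn.continuousWithinAt (right_mem_Icc.2 (zero_le_one' ℝ))
    exact (hc.eventually (Metric.ball_mem_nhds (β 1) hρ)).filter_mono hle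
  filter_upwards [h1, h2] with x hx hxρ
  rw [dist_zero_right]
  refine hgood (β x) ?_ (hτ.lt_swallowingTime_of_mem_interior hW hAarc hreal (hβ.mem_interior hx))
  rw [← dist_eq_norm, ← hβ.apply_one]
  exact hxρ

end Literature.Probability.RandomPlanarGeometry
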